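import Mathlib
import HarnessLib
import Summits.Ventures.LatticeQCDFlow.Exactness.SphereIndependenceSamplerAcceptance
import Summits.Ventures.LatticeQCDFlow.Exactness.LatticeBoundedDifferences

/-!
# Acceptance controls total variation on the lattice of spheres: `|∫ g d(π̄.tilted(−F)) − ∫ g dπ̄| ≤ 2M(1 − acc)` and `|Cov_{π̄.tilted(−F)} − Cov_π̄| ≤ 6ab(1 − acc)` for every independence sampler

HONEST FRAMING: exact (Metropolis-corrected) sampling algorithms for lattice gauge theory;
figures of merit are autocorrelation/cost numbers at stated couplings and volumes; no
continuum-physics claim.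

Venture `LatticeQCDFlow` (cell pub-lqcd), topic `Exactness`; FANOUT row 7 (`s0-cpn-null`).  NEW
WORK of the cell over this leg's `Exactness/SphereIndependenceSamplerAcceptance.lean`
(`indepSampler_meanAccept_eq`: the mean acceptance is `∫∫e^{−max(F,F')}dπ̄dπ̄/∫e^{−F}dπ̄`) and
`Exactness/LatticeBoundedDifferences.lean` (a probability space is nonempty), GEN-15's
`Exactness/SphereFlowLiouvilleMeasure.lean` (`integral_spherePi_tilted`); nothing is cited as a fact.
Printed counterpart, NAMED ONLY: lean-2's finite-state `Scaling/Acceptance.lean`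
(`accRate ≤ 1 − ‖p − q‖_TV`); the acceptance discussion of Albergo–Kanwar–Shanahan 2019 §II.  THIS
FILE is the continuous-configuration-space form; the Gibbs-law instance (the acceptance–footprint law
of the exact leading-order flow) is the sequel `Exactness/SphereLOFlowAcceptanceFootprint.lean`.

## Content (`F` a continuous log-weight on `Ω`; `acc` the mean Metropolis acceptance of the
## independence sampler with target `π̄.tilted(−F)` and proposal `π̄`)

* **`abs_integral_tilted_sub_integral_le`** — for every continuous `g` with `|g| ≤ M`:
  `|∫ g d(π̄.tilted(−F)) − ∫ g dπ̄| ≤ 2M·(1 − acc)` (`∫∫|w − w'| = 2(∫w)(1 − acc)` for `w = e^{−F}`,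
  and `|w − ∫w| ≤ ∫|w − w'|`): `‖π̄.tilted(−F) − π̄‖_TV ≤ 1 − acc`, tested on continuous functions.
* **`abs_cov_tilted_sub_cov_le`** — for continuous `X`, `Y` bounded by `a`, `b`:
  `|Cov_{π̄.tilted(−F)}(X, Y) − Cov_π̄(X, Y)| ≤ 6ab·(1 − acc)`.

NOT CLAIMED: the converse sandwich `1 − 2‖·‖_TV ≤ acc`; anything model-specific.
-/

noncomputable section

namespace Summit.Ventures.LatticeQCDFlow.Exactness

open Function Set Metric MeasureTheory NormedSpace InnerProductSpace
open scoped RealInnerProductSpace Topology Nat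

variable {Λ : Type*} {E : Type*} [NormedAddCommGroup E] [InnerProductSpace ℝ E]
  [FiniteDimensional ℝ E] [Fintype Λ] [DecidableEq Λ] [MeasurableSpace E] [BorelSpace E] [Nontrivial E]

/-! ## §1 Acceptance controls the total variation between target and proposal -/

section TV

omit [DecidableEq Λ] in
/-- **ACCEPTANCE CONTROLS TOTAL VARIATION.**  For a continuous log-weight `F` and a continuous `g`
with `|g| ≤ M` on `Ω`: `|∫ g d(π̄.tilted(−F)) − ∫ g dπ̄| ≤ 2M·(1 − acc)`, `acc` the mean Metropolis
acceptance of the independence sampler with target `π̄.tilted(−F)` and proposal `π̄`. -/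
theorem abs_integral_tilted_sub_integral_le {F : (Λ → sphere (0 : E) 1) → ℝ} (hF : Continuous F)
    {g : (Λ → sphere (0 : E) 1) → ℝ} (hg : Continuous g) {M : ℝ} (hM : ∀ ω, |g ω| ≤ M) :
    |∫ ω, g ω ∂(Measure.pi (fun _ : Λ => uniformSphere (volume : Measure E))).tilted (fun ω => -F ω) -
        ∫ ω, g ω ∂Measure.pi (fun _ : Λ => uniformSphere (volume : Measure E))| ≤
      2 * M * (1 - ∫ ω, (∫ ω', min 1 (Real.exp (F ω - F ω'))
          ∂Measure.pi (fun _ : Λ => uniformSphere (volume : Measure E)))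
        ∂(Measure.pi (fun _ : Λ => uniformSphere (volume : Measure E))).tilted (fun ω => -F ω)) := by
  set μ : Measure (Λ → sphere (0 : E) 1) := Measure.pi (fun _ : Λ => uniformSphere (volume : Measure E))
    with hμ
  rw [indepSampler_meanAccept_eq F, integral_spherePi_tilted]
  set w : (Λ → sphere (0 : E) 1) → ℝ := fun ω => Real.exp (-F ω) with hw
  set Z : ℝ := ∫ ω, w ω ∂μ with hZ
  set I : ℝ := ∫ ω, ∫ ω', |w ω - w ω'| ∂μ ∂μ with hI
  have hwc : Continuous w := Real.continuous_exp.comp hF.neg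
  have hwi : Integrable w μ := integrable_pi_of_continuous _ hwc
  have hZpos : 0 < Z := integral_exp_pos hwi
  have hM0 : 0 ≤ M := le_trans (abs_nonneg _) (hM (Classical.choice
    (nonempty_of_isProbabilityMeasure μ)))
  -- `min(w, w') = (w + w')/2 − |w − w'|/2` and the numerator of the acceptance
  have habsc : ∀ ω, Continuous fun ω' => |w ω - w ω'| := fun ω => (continuous_const.sub hwc).abs
  have hinner : ∀ ω, ∫ ω', Real.exp (-max (F ω) (F ω')) ∂μ =
      (1 / 2) * w ω + (1 / 2) * Z - (1 / 2) * ∫ ω', |w ω - w ω'| ∂μ := by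
    intro ω
    have e : ∀ ω', Real.exp (-max (F ω) (F ω')) =
        ((1 / 2) * w ω + (1 / 2) * w ω') - (1 / 2) * |w ω - w ω'| := by
      intro ω'
      simp only [hw]
      rcases le_total (F ω) (F ω') with h | h
      · rw [max_eq_right h, abs_of_nonneg (sub_nonneg.2 (Real.exp_le_exp.2 (neg_le_neg h)))]; ring
      · rw [max_eq_left h, abs_of_nonpos (sub_nonpos.2 (Real.exp_le_exp.2 (neg_le_neg h)))]; ring
    simp_rw [e]
    have hi1 : Integrable (fun ω' => (1 / 2) * w ω') μ := hwi.const_mul _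
    have hi2 : Integrable (fun ω' => (1 / 2) * w ω + (1 / 2) * w ω') μ := (integrable_const _).add hi1
    have hi3 : Integrable (fun ω' => (1 / 2) * |w ω - w ω'|) μ :=
      (integrable_pi_of_continuous _ (habsc ω)).const_mul _
    rw [integral_sub hi2 hi3, integral_add (integrable_const _) hi1, integral_const_mul,
      integral_const_mul, integral_const_mul, integral_const, smul_eq_mul, probReal_univ, one_mul,
      ← hZ]
  have hIc : Continuous fun ω => ∫ ω', |w ω - w ω'| ∂μ := by
    have hf : Continuous (uncurry fun (ω : Λ → sphere (0 : E) 1) (ω' : Λ → sphere (0 : E) 1) =>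
        |w ω - w ω'|) := ((hwc.comp continuous_fst).sub (hwc.comp continuous_snd)).abs
    have h := continuous_parametric_integral_of_continuous (μ := μ) hf isCompact_univ
    simp only [Measure.restrict_univ] at h
    exact h
  have hIi : Integrable (fun ω => ∫ ω', |w ω - w ω'| ∂μ) μ := integrable_pi_of_continuous _ hIc
  have hN : ∫ ω, ∫ ω', Real.exp (-max (F ω) (F ω')) ∂μ ∂μ = Z - (1 / 2) * I := by
    simp_rw [hinner]
    have hi1 : Integrable (fun ω => (1 / 2) * w ω) μ := hwi.const_mul _
    have hi2 : Integrable (fun ω => (1 / 2) * w ω + (1 / 2) * Z) μ := hi1.add (integrable_const _)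
    have hi3 : Integrable (fun ω => (1 / 2) * ∫ ω', |w ω - w ω'| ∂μ) μ := hIi.const_mul _
    rw [integral_sub hi2 hi3, integral_add hi1 (integrable_const _), integral_const_mul,
      integral_const_mul, integral_const_mul, integral_const, smul_eq_mul, probReal_univ, one_mul,
      ← hZ, ← hI]
    ring
  -- `1 − acc = I/(2Z)`
  have hacc : 1 - (Z - (1 / 2) * I) / Z = I / (2 * Z) := by
    have hZ0 : Z ≠ 0 := hZpos.ne'
    field_simp
    try ring
  rw [hN, hacc]
  -- the difference of the two expectations is `(∫ (w − Z) g)/Z`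
  have hgi : Integrable g μ := integrable_pi_of_continuous _ hg
  have hwgi : Integrable (fun ω => w ω * g ω) μ := integrable_pi_of_continuous _ (hwc.mul hg)
  have hdiff : (∫ ω, w ω * g ω ∂μ) / Z - ∫ ω, g ω ∂μ = (∫ ω, (w ω - Z) * g ω ∂μ) / Z := by
    have e : ∀ ω, (w ω - Z) * g ω = w ω * g ω - Z * g ω := by intro ω; ring
    simp_rw [e]
    rw [integral_sub hwgi (hgi.const_mul Z), integral_const_mul]
    field_simp
  rw [hdiff, abs_div, abs_of_pos hZpos, div_le_iff₀ hZpos]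
  -- `|∫ (w − Z) g| ≤ M ∫ |w − Z| ≤ M · I`
  have h1 : |∫ ω, (w ω - Z) * g ω ∂μ| ≤ M * ∫ ω, |w ω - Z| ∂μ := by
    refine (abs_integral_le_integral_abs).trans ?_
    rw [← integral_const_mul]
    refine integral_mono ((integrable_pi_of_continuous _ ((hwc.sub continuous_const).mul hg)).abs)
      ((integrable_pi_of_continuous _ (hwc.sub continuous_const).abs).const_mul M) fun ω => ?_
    simp only
    rw [abs_mul, mul_comm M]
    exact mul_le_mul_of_nonneg_left (hM ω) (abs_nonneg _)
  have h2 : ∫ ω, |w ω - Z| ∂μ ≤ I := by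
    refine integral_mono (integrable_pi_of_continuous _ (hwc.sub continuous_const).abs) hIi fun ω => ?_
    simp only
    have e : w ω - Z = ∫ ω', (w ω - w ω') ∂μ := by
      rw [integral_sub (integrable_const _) hwi, integral_const, smul_eq_mul, probReal_univ, one_mul]
    rw [e]
    exact abs_integral_le_integral_abs
  calc |∫ ω, (w ω - Z) * g ω ∂μ| ≤ M * I := h1.trans (mul_le_mul_of_nonneg_left h2 hM0)
    _ = 2 * M * (I / (2 * Z)) * Z := by
        have hZ0 : Z ≠ 0 := hZpos.ne'
        field_simp
        try ring

omit [DecidableEq Λ] in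
/-- **ACCEPTANCE CONTROLS THE CHANGE OF COVARIANCES**: for continuous `X`, `Y` on `Ω` bounded by
`a`, `b`: `|Cov_{π̄.tilted(−F)}(X, Y) − Cov_π̄(X, Y)| ≤ 6ab·(1 − acc)`. -/
theorem abs_cov_tilted_sub_cov_le {F : (Λ → sphere (0 : E) 1) → ℝ} (hF : Continuous F)
    {X Y : (Λ → sphere (0 : E) 1) → ℝ} (hX : Continuous X) (hY : Continuous Y) {a b : ℝ}
    (ha : ∀ ω, |X ω| ≤ a) (hb : ∀ ω, |Y ω| ≤ b) :
    |(∫ ω, X ω * Y ω ∂(Measure.pi (fun _ : Λ => uniformSphere (volume : Measure E))).tilted (fun ω => -F ω) -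
        (∫ ω, X ω ∂(Measure.pi (fun _ : Λ => uniformSphere (volume : Measure E))).tilted (fun ω => -F ω)) *
          ∫ ω, Y ω ∂(Measure.pi (fun _ : Λ => uniformSphere (volume : Measure E))).tilted (fun ω => -F ω)) -
      (∫ ω, X ω * Y ω ∂Measure.pi (fun _ : Λ => uniformSphere (volume : Measure E)) -
        (∫ ω, X ω ∂Measure.pi (fun _ : Λ => uniformSphere (volume : Measure E))) *
          ∫ ω, Y ω ∂Measure.pi (fun _ : Λ => uniformSphere (volume : Measure E)))| ≤
      6 * (a * b) * (1 - ∫ ω, (∫ ω', min 1 (Real.exp (F ω - F ω'))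
          ∂Measure.pi (fun _ : Λ => uniformSphere (volume : Measure E)))
        ∂(Measure.pi (fun _ : Λ => uniformSphere (volume : Measure E))).tilted (fun ω => -F ω)) := by
  set μ : Measure (Λ → sphere (0 : E) 1) := Measure.pi (fun _ : Λ => uniformSphere (volume : Measure E))
    with hμ
  set ν : Measure (Λ → sphere (0 : E) 1) := μ.tilted (fun ω => -F ω) with hν
  set r : ℝ := 1 - ∫ ω, (∫ ω', min 1 (Real.exp (F ω - F ω')) ∂μ) ∂ν with hr
  have ha0 : 0 ≤ a := le_trans (abs_nonneg _) (ha (Classical.choice (nonempty_of_isProbabilityMeasure μ)))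
  have hb0 : 0 ≤ b := le_trans (abs_nonneg _) (hb (Classical.choice (nonempty_of_isProbabilityMeasure μ)))
  -- the three total-variation estimates
  have hXY : |∫ ω, X ω * Y ω ∂ν - ∫ ω, X ω * Y ω ∂μ| ≤ 2 * (a * b) * r :=
    abs_integral_tilted_sub_integral_le hF (g := fun ω => X ω * Y ω) (hX.mul hY) fun ω => by
      show |X ω * Y ω| ≤ a * b
      rw [abs_mul]; exact mul_le_mul (ha ω) (hb ω) (abs_nonneg _) ha0
  have hXd : |∫ ω, X ω ∂ν - ∫ ω, X ω ∂μ| ≤ 2 * a * r := abs_integral_tilted_sub_integral_le hF hX ha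
  have hYd : |∫ ω, Y ω ∂ν - ∫ ω, Y ω ∂μ| ≤ 2 * b * r := abs_integral_tilted_sub_integral_le hF hY hb
  -- bounds on the means
  haveI : IsProbabilityMeasure ν := isProbabilityMeasure_spherePi_tilted hF.neg
  have hmean : ∀ {ρ : Measure (Λ → sphere (0 : E) 1)} [IsProbabilityMeasure ρ] {U : (Λ → sphere (0 : E) 1) → ℝ}
      {s : ℝ}, Continuous U → (∀ ω, |U ω| ≤ s) → |∫ ω, U ω ∂ρ| ≤ s := by
    intro ρ _ U s hU hs
    refine (abs_integral_le_integral_abs).trans ?_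
    have h := integral_mono (μ := ρ) ((hU.integrable_of_hasCompactSupport
      (HasCompactSupport.of_compactSpace _)).abs) (integrable_const s) hs
    simp only [integral_const, smul_eq_mul, probReal_univ, one_mul] at h
    exact h
  have hXν : |∫ ω, X ω ∂ν| ≤ a := hmean hX ha
  have hYμ : |∫ ω, Y ω ∂μ| ≤ b := hmean hY hb
  -- algebra
  have e : (∫ ω, X ω * Y ω ∂ν - (∫ ω, X ω ∂ν) * ∫ ω, Y ω ∂ν) -
      (∫ ω, X ω * Y ω ∂μ - (∫ ω, X ω ∂μ) * ∫ ω, Y ω ∂μ) =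
      (∫ ω, X ω * Y ω ∂ν - ∫ ω, X ω * Y ω ∂μ) -
        ((∫ ω, X ω ∂ν) * ((∫ ω, Y ω ∂ν) - ∫ ω, Y ω ∂μ) +
          ((∫ ω, X ω ∂ν) - ∫ ω, X ω ∂μ) * ∫ ω, Y ω ∂μ) := by ring
  rw [e]
  refine (abs_sub _ _).trans ?_
  have h2 : |(∫ ω, X ω ∂ν) * ((∫ ω, Y ω ∂ν) - ∫ ω, Y ω ∂μ) +
      ((∫ ω, X ω ∂ν) - ∫ ω, X ω ∂μ) * ∫ ω, Y ω ∂μ| ≤ a * (2 * b * r) + (2 * a * r) * b := by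
    refine (abs_add_le _ _).trans ?_
    rw [abs_mul, abs_mul]
    exact add_le_add (mul_le_mul hXν hYd (abs_nonneg _) ha0)
      (mul_le_mul hXd hYμ (abs_nonneg _) (le_trans (abs_nonneg _) hXd))
  linarith

end TV

end Summit.Ventures.LatticeQCDFlow.Exactness

end
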